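import Summits.ABC.IUTFork.Cor312PinnedIndTrivialEngineBeds
import HarnessLib

/-!
# [IUTchIII] Cor. 3.12 — THE UNIT LAW: over abc-iut-w4-d101's unit shells, (Ind)-trivial ⟺ every Θ-region is stable under every `p`-adic unit

Proof-only junction file (D-0012; NO definition, NO `Prop` fact) of the abc-iut cell (WAVE-5 prover abc-iut-w5-d068, gen 5), companion of the
three laws of `Cor312PinnedIndTrivialBeds5` (v2 §4 THE SCALAR LAW over abc-iut-w4-d098's `scalarShells p U`; v3 §6 THE GENERATOR LAW over any
situation; v3 §7 THE SIGN LAW over abc-iut-w5-d247's sign shells) for the third shell type of the beds of record — abc-iut-w4-d101's UNIT SHELLS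
`UnitWitness.unitShells p` (`Cor312UnitShells`, p429309: «Ism» = strip-automorphisms = multiplication by the `p`-adic units of `ℚ`; beds U, unit-P♭,
COSET, K). TAKES NO SIDE on [IUTchIII] Cor. 3.12 or on any author; toy carriers; instantiated ≠ endorsed.

RESULTS (ns `Summit.ABC.IUTFork.Cor312Vol.IndTrivial`):
* `apply_eq_smul_of_mem_closure_unitShells` — every element of ⟨(Ind1) ∪ (Ind2)⟩ of the unit shells acts on a given packet as `x ↦ c • x` for a
  `p`-adic unit `c` (abc-iut-w4-d101's closure lemma `actsByUnits_of_mem_closure`, read through the line coordinate);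
* `exists_mem_Ind2Family_apply_eq_smul_unitShells` — conversely EVERY `p`-adic unit `c` is realised at every packet by an (Ind2)-family (the unit
  `c` on the first tensor factor, the identity on the others — abc-iut-w5-d230's `flipFamily` pattern with `c` for `−1`);
* **`indTrivial_iff_units_stable` — THE UNIT LAW**: for ANY situation `⟨unitShells p, D, G⟩` and ANY setting over it, (Ind)-trivial ⟺ every
  (Ind3)-enlarged Θ-region is stable under `x ↦ c • x` for every `p`-adic unit `c`; `possibleImages_eq_unitOrbit` — the possible images at a packet are
  EXACTLY the unit orbit `{c • A | c a p-adic unit}` of `A = thetaRegion3`.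
So for the three scalar-type shells of the ledger the (Ind)-content of a bed is ONE BIT of its Θ-region: symmetric under `−1` (sign shells), stable
under the `p`-adic units (unit shells: balls YES — U, unit-P♭; coset pairs `±ε q^{j²}(1+p𝒪)` NO for `p ≥ 7` — COSET, K), resp. «every scalar of `U` is
a unit» (scalar shells with ball glue). Consumed BY NAME; standard axioms; typed ≠ proved. [claim: Mochizuki2012, status: disputed]
[cite: ScholzeStix2018, §2.2 pp. 9–10]
-/

noncomputable section

open Set
open scoped Pointwise

namespace Summit.ABC.IUTFork.Cor312Vol.IndTrivial

open Thm311 Cor312 Cor312.IdentifiedNonVacuity Cor312Vol NaiveWitness NaturalWitness Literature.IUT.LogThetaLattice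

section UnitLaw

variable (p : ℕ) [hp : Fact p.Prime]

/-- **Every element of ⟨(Ind1) ∪ (Ind2)⟩ of the unit shells acts on a given packet as `x ↦ c • x` for some `p`-adic unit `c`**
(abc-iut-w4-d101's `actsByUnits_of_mem_closure`: `line (Φ x) = c·line x`; the line coordinate is a linear isomorphism). [folklore] -/
theorem apply_eq_smul_of_mem_closure_unitShells {Φ : (UnitWitness.unitShells p).PacketAut}
    (hΦ : Φ ∈ Subgroup.closure ((UnitWitness.unitShells p).Ind1Family ∪ (UnitWitness.unitShells p).Ind2Family))
    (j : Checks.toyIndex.Label) (vQ : Checks.toyIndex.VQ) :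
    ∃ c : ℚ, UnitWitness.IsPUnit p c ∧ ∀ x, Φ j vQ x = c • x := by
  obtain ⟨c, hc, hΦc⟩ := (UnitWitness.actsByUnits_of_mem_closure hΦ).unit j vQ
  exact ⟨c, hc, fun x => (line j vQ).injective ((hΦc x).trans ((map_smul (line j vQ) c x).trans (smul_eq_mul c _)).symm)⟩

omit hp in
/-- **Every `p`-adic unit is realised at every packet by an (Ind2)-family**: the family «`c` on the first tensor factor, `1` on the others» (an
element of (Ind2) since `c ∈ Ism`) acts on the packet at `(j, v_ℚ)` as `x ↦ c • x` (multilinearity: the scalar is `c·1⋯1 = c`). [folklore] -/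
theorem exists_mem_Ind2Family_apply_eq_smul_unitShells {c : ℚ} (hc : UnitWitness.IsPUnit p c)
    (j : Checks.toyIndex.Label) (vQ : Checks.toyIndex.VQ) :
    ∃ Φ ∈ (UnitWitness.unitShells p).Ind2Family, ∀ x, Φ j vQ x = c • x := by
  refine ⟨fun j' vQ' => (UnitWitness.unitShells p).factorwise j' vQ' fun i => (UnitWitness.unitShells p).summandwise vQ' fun _ =>
      if i = 0 then UnitWitness.mulEquiv c hc.1 else LinearEquiv.refl ℚ ℚ, fun j' vQ' => ⟨fun i _ =>
      if i = 0 then UnitWitness.mulEquiv c hc.1 else LinearEquiv.refl ℚ ℚ, fun i _ => ?_, rfl⟩, fun x => ?_⟩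
  · show (if i = 0 then UnitWitness.mulEquiv c hc.1 else LinearEquiv.refl ℚ ℚ) ∈ UnitWitness.padicUnits p
    by_cases h : i = 0
    · rw [if_pos h]; exact UnitWitness.mulEquiv_mem_padicUnits p hc
    · rw [if_neg h]; exact UnitWitness.refl_mem_padicUnits p
  · apply (line j vQ).injective
    have h := line_factorwise_of_smul j vQ
      (fun i => (UnitWitness.unitShells p).summandwise vQ fun _ => if i = 0 then UnitWitness.mulEquiv c hc.1 else LinearEquiv.refl ℚ ℚ)
      (fun i => if i = 0 then c else 1) (fun i y => by
        funext v
        by_cases h : i = 0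
        · show (if i = 0 then UnitWitness.mulEquiv c hc.1 else LinearEquiv.refl ℚ ℚ) (y v) = ((if i = 0 then c else (1 : ℚ)) • y) v
          rw [if_pos h, if_pos h]; rfl
        · show (if i = 0 then UnitWitness.mulEquiv c hc.1 else LinearEquiv.refl ℚ ℚ) (y v) = ((if i = 0 then c else (1 : ℚ)) • y) v
          rw [if_neg h, if_neg h, one_smul]; rfl) x
    rw [Finset.prod_ite_eq', if_pos (Finset.mem_univ _)] at h
    exact h.trans ((map_smul (line j vQ) c x).trans (smul_eq_mul c _)).symm

variable (D : ℤ → MRData (UnitWitness.unitShells p))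
  (G : ∀ (n : ℤ) (j : Checks.toyIndex.LabelStar), GlobalDegrees (UnitWitness.unitShells p) j)
  (P : Cor312.Setting (⟨UnitWitness.unitShells p, D, G⟩ : Situation Checks.toyIndex))

/-- **THE UNIT LAW.** For ANY situation `⟨unitShells p, D, G⟩` over abc-iut-w4-d101's unit shells (arbitrary vertical lines and degrees) and ANY
Cor.-3.12 setting `P` over it: `P` is (Ind)-trivial **iff every (Ind3)-enlarged Θ-region is STABLE UNDER EVERY `p`-ADIC UNIT** (`c • A = A` for
all `c` with `v_p(c) = 0`). ⇒: the unit `c` is realised by an (Ind2)-family (`exists_mem_Ind2Family_apply_eq_smul_unitShells`); ⇐: every group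
element is a unit homothety on each packet (`apply_eq_smul_of_mem_closure_unitShells`). Balls are unit-stable (U, unit-P♭: (Ind)-TRIVIAL —
abc-iut-w4-d101's `image_uBall_of_mem_closure`); the coset pairs `±ε·q^{j²}(1+p𝒪)` are not once `p ≥ 7` (COSET, K: NOT (Ind)-trivial). [folklore] -/
theorem indTrivial_iff_units_stable :
    (∀ Φ ∈ Setting.indGroup (⟨UnitWitness.unitShells p, D, G⟩ : Situation Checks.toyIndex), ∀ (j : Checks.toyIndex.Label) (vQ : Checks.toyIndex.VQ),
        Φ j vQ '' P.thetaRegion3 j vQ = P.thetaRegion3 j vQ) ↔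
      ∀ c : ℚ, UnitWitness.IsPUnit p c → ∀ (j : Checks.toyIndex.Label) (vQ : Checks.toyIndex.VQ),
        (fun x => c • x) '' P.thetaRegion3 j vQ = P.thetaRegion3 j vQ := by
  constructor
  · intro hfix c hc j vQ
    obtain ⟨Φ, hΦ, hΦc⟩ := exists_mem_Ind2Family_apply_eq_smul_unitShells p hc j vQ
    rw [← Set.image_congr fun x (_ : x ∈ P.thetaRegion3 j vQ) => hΦc x]
    exact hfix Φ (Subgroup.subset_closure (Or.inr hΦ)) j vQ
  · intro hstab Φ hΦ j vQ
    obtain ⟨c, hc, hΦc⟩ := apply_eq_smul_of_mem_closure_unitShells p hΦ j vQ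
    rw [Set.image_congr fun x (_ : x ∈ P.thetaRegion3 j vQ) => hΦc x]
    exact hstab c hc j vQ

/-- **The possible images over the unit shells are the UNIT ORBIT of the Θ-region**: `{c • A | c a p-adic unit}`, `A = thetaRegion3`.
[folklore] -/
theorem possibleImages_eq_unitOrbit (j : Checks.toyIndex.Label) (vQ : Checks.toyIndex.VQ) :
    P.possibleImages j vQ = {U | ∃ c : ℚ, UnitWitness.IsPUnit p c ∧ U = (fun x => c • x) '' P.thetaRegion3 j vQ} := by
  ext U
  constructor
  · rintro ⟨Φ, hΦ, rfl⟩
    obtain ⟨c, hc, hΦc⟩ := apply_eq_smul_of_mem_closure_unitShells p hΦ j vQ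
    exact ⟨c, hc, Set.image_congr fun x _ => hΦc x⟩
  · rintro ⟨c, hc, rfl⟩
    obtain ⟨Φ, hΦ, hΦc⟩ := exists_mem_Ind2Family_apply_eq_smul_unitShells p hc j vQ
    exact ⟨Φ, Subgroup.subset_closure (Or.inr hΦ), (Set.image_congr fun x _ => hΦc x).symm⟩

/-- One-witness form of NON-triviality over the unit shells: a single `p`-adic unit moving one Θ-region refutes (Ind)-triviality (the shape of
abc-iut-w4-d101's COSET / K cells: `u₀ = 1 + p` moves the pair at the label `1` once `p ≥ 7`). [folklore] -/
theorem not_indTrivial_of_unit_moves_unitShells {c : ℚ} (hc : UnitWitness.IsPUnit p c) {j : Checks.toyIndex.Label} {vQ : Checks.toyIndex.VQ}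
    (hne : (fun x => c • x) '' P.thetaRegion3 j vQ ≠ P.thetaRegion3 j vQ) :
    ¬ ∀ Φ ∈ Setting.indGroup (⟨UnitWitness.unitShells p, D, G⟩ : Situation Checks.toyIndex), ∀ (j : Checks.toyIndex.Label) (vQ : Checks.toyIndex.VQ),
        Φ j vQ '' P.thetaRegion3 j vQ = P.thetaRegion3 j vQ := fun hfix =>
  hne ((indTrivial_iff_units_stable p D G P).1 hfix c hc j vQ)

end UnitLaw

end Summit.ABC.IUTFork.Cor312Vol.IndTrivial

end
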